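import Mathlib

/-!
# The shielding inequality (tower property + generalised Hölder)

Stub C2 of the line `Sketch` (markov-shielding) for the crux `TemperedCurvatureMoments`
(stmt-QuantumFields-17721).

If bounded real observables `φ₀, …, φₙ₋₁` on a probability space `(Ω, m0, μ)` are conditionally
independent given a sub-σ-algebra `m ≤ m0` in the PRODUCT form
`μ[∏ᵢ φᵢ | m] = ∏ᵢ μ[φᵢ | m]` a.e., then the `n`-point moment is shielded by the `Lⁿ` norms of the
conditional means:

  `|∫ ∏ᵢ φᵢ dμ| ≤ ∏ᵢ (∫ |μ[φᵢ | m]|ⁿ dμ) ^ (1/n)`.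

Proof: the tower property `∫ ∏ᵢ φᵢ = ∫ μ[∏ᵢ φᵢ | m]` (`MeasureTheory.integral_condExp`), the
hypothesis, and the finite-family Hölder inequality with all `n` exponents equal to `n`
(`ENNReal.lintegral_prod_norm_pow_le`, transported to the Bochner integral; the conditional means are
a.e. bounded, `MeasureTheory.ae_bdd_abs_condExp_of_ae_bdd_abs`, so every `Lⁿ` norm is finite).
[folklore]
-/

noncomputable section

namespace Summit.QuantumFields.YangMills.Theorems.TemperedCurvatureMoments.Sketch

open scoped BigOperators ENNReal
open MeasureTheory ProbabilityTheory Filter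

/-- **Generalised Hölder inequality, `n` factors, all exponents equal to `n`.**  For a.e.-bounded,
a.e.-strongly measurable real functions `g₀, …, gₙ₋₁` on a finite measure space,
`|∫ ∏ᵢ gᵢ dμ| ≤ ∏ᵢ (∫ |gᵢ|ⁿ dμ) ^ (1/n)`.  Transport of `ENNReal.lintegral_prod_norm_pow_le`
(exponents `pᵢ = 1/n`, functions `‖gᵢ‖ₑⁿ`) to the Bochner integral. -/
private theorem abs_integral_prod_le_of_ae_bdd {Ω : Type*} [MeasurableSpace Ω] {μ : Measure Ω}
    [IsFiniteMeasure μ] {n : ℕ} (hn : 0 < n) (g : Fin n → Ω → ℝ)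
    (hgm : ∀ i, AEStronglyMeasurable (g i) μ) (hgb : ∀ i, ∃ M : ℝ, ∀ᵐ ω ∂μ, |g i ω| ≤ M) :
    |∫ ω, ∏ i, g i ω ∂μ| ≤ ∏ i, (∫ ω, |g i ω| ^ n ∂μ) ^ ((n : ℝ)⁻¹) := by
  have hn0 : (n : ℝ) ≠ 0 := Nat.cast_ne_zero.mpr hn.ne'
  -- (A) `|∫ ∏ gᵢ| ≤ ∫ ∏ |gᵢ|`
  have hA : |∫ ω, ∏ i, g i ω ∂μ| ≤ ∫ ω, ∏ i, |g i ω| ∂μ := by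
    refine abs_integral_le_integral_abs.trans_eq ?_
    simp only [Finset.abs_prod]
  -- (B) `∫ ∏ |gᵢ| = (∫⁻ ∏ ‖gᵢ‖ₑ).toReal`
  have hB : ∫ ω, ∏ i, |g i ω| ∂μ = (∫⁻ ω, ∏ i, ‖g i ω‖ₑ ∂μ).toReal := by
    rw [integral_eq_lintegral_of_nonneg_ae (f := fun ω => ∏ i, |g i ω|)
      (Eventually.of_forall fun ω => Finset.prod_nonneg fun i _ => abs_nonneg (g i ω))
      (Finset.aestronglyMeasurable_fun_prod _ fun i _ =>
        continuous_abs.comp_aestronglyMeasurable (hgm i))]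
    congr 1
    refine lintegral_congr fun ω => ?_
    rw [ENNReal.ofReal_prod_of_nonneg fun i _ => abs_nonneg (g i ω)]
    exact Finset.prod_congr rfl fun i _ => (Real.enorm_eq_ofReal_abs _).symm
  -- (C) `∫ |gᵢ|ⁿ = (∫⁻ ‖gᵢ‖ₑⁿ).toReal`
  have hC : ∀ i, ∫ ω, |g i ω| ^ n ∂μ = (∫⁻ ω, ‖g i ω‖ₑ ^ (n : ℝ) ∂μ).toReal := by
    intro i
    rw [integral_eq_lintegral_of_nonneg_ae (f := fun ω => |g i ω| ^ n)
      (Eventually.of_forall fun ω => pow_nonneg (abs_nonneg (g i ω)) n)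
      ((continuous_pow n).comp_aestronglyMeasurable
        (continuous_abs.comp_aestronglyMeasurable (hgm i)))]
    congr 1
    refine lintegral_congr fun ω => ?_
    rw [ENNReal.ofReal_pow (abs_nonneg _), ← Real.enorm_eq_ofReal_abs, ENNReal.rpow_natCast]
  -- (D) every `Lⁿ` norm is finite (the `gᵢ` are a.e. bounded on a finite measure space)
  have hD : ∀ i, ∫⁻ ω, ‖g i ω‖ₑ ^ (n : ℝ) ∂μ ≠ ∞ := by
    intro i
    obtain ⟨M, hM⟩ := hgb i
    refine ne_top_of_le_ne_top ?_
      (lintegral_mono_ae (g := fun _ => ENNReal.ofReal M ^ (n : ℝ)) ?_)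
    · rw [lintegral_const]
      exact ENNReal.mul_ne_top (ENNReal.rpow_ne_top_of_nonneg n.cast_nonneg ENNReal.ofReal_ne_top)
        (measure_ne_top μ _)
    · filter_upwards [hM] with ω hω
      rw [Real.enorm_eq_ofReal_abs]
      exact ENNReal.rpow_le_rpow (ENNReal.ofReal_le_ofReal hω) n.cast_nonneg
  -- (E) Hölder with exponents `pᵢ = 1/n` applied to `‖gᵢ‖ₑⁿ`
  have hE : ∫⁻ ω, ∏ i, ‖g i ω‖ₑ ∂μ ≤ ∏ i, (∫⁻ ω, ‖g i ω‖ₑ ^ (n : ℝ) ∂μ) ^ (n : ℝ)⁻¹ := by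
    have key := ENNReal.lintegral_prod_norm_pow_le (μ := μ) Finset.univ
      (f := fun i ω => ‖g i ω‖ₑ ^ (n : ℝ)) (p := fun _ => (n : ℝ)⁻¹)
      (fun i _ => (hgm i).aemeasurable.enorm.pow_const _)
      (by rw [Finset.sum_const, Finset.card_univ, Fintype.card_fin, nsmul_eq_mul,
        mul_inv_cancel₀ hn0])
      (fun i _ => inv_nonneg.mpr n.cast_nonneg)
    simp only [ENNReal.rpow_rpow_inv hn0] at key
    exact key
  calc |∫ ω, ∏ i, g i ω ∂μ| ≤ ∫ ω, ∏ i, |g i ω| ∂μ := hA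
    _ = (∫⁻ ω, ∏ i, ‖g i ω‖ₑ ∂μ).toReal := hB
    _ ≤ (∏ i, (∫⁻ ω, ‖g i ω‖ₑ ^ (n : ℝ) ∂μ) ^ (n : ℝ)⁻¹).toReal :=
      ENNReal.toReal_mono (ENNReal.prod_ne_top fun i _ =>
        ENNReal.rpow_ne_top_of_nonneg (inv_nonneg.mpr n.cast_nonneg) (hD i)) hE
    _ = ∏ i, (∫ ω, |g i ω| ^ n ∂μ) ^ ((n : ℝ)⁻¹) := by
      rw [ENNReal.toReal_prod]
      exact Finset.prod_congr rfl fun i _ => by rw [hC i, ENNReal.toReal_rpow]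

/-- **Stub C2 — the shielding inequality (tower + generalised Hölder).**  If bounded observables `φᵢ` are
conditionally independent given `m` in the product sense, then `|E ∏ᵢ φᵢ| ≤ ∏ᵢ ‖E[φᵢ | m]‖_{Lⁿ}` (`n`
factors, exponents all equal to `n`; Mathlib `integral_condExp`, `ENNReal.lintegral_prod_norm_pow_le`).
[folklore] -/
theorem stub_shieldingHoelder {Ω : Type*} {m m0 : MeasurableSpace Ω} (hm : m ≤ m0) (μ : Measure Ω)
    [IsProbabilityMeasure μ] {n : ℕ} (hn : 0 < n) (φ : Fin n → Ω → ℝ)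
    (hφm : ∀ i, AEStronglyMeasurable (φ i) μ) (hφb : ∀ i, ∃ M : ℝ, ∀ ω, |φ i ω| ≤ M)
    (hci : μ[(fun ω => ∏ i, φ i ω) | m] =ᵐ[μ] fun ω => ∏ i, (μ[φ i | m]) ω) :
    |∫ ω, ∏ i, φ i ω ∂μ| ≤ ∏ i, (∫ ω, |(μ[φ i | m]) ω| ^ n ∂μ) ^ ((n : ℝ)⁻¹) := by
  -- the a.e.-strong measurability of the `φᵢ` is not needed: `integral_condExp` is unconditional
  have _ := hφm
  -- tower property + conditional independence in product form
  have key : ∫ ω, ∏ i, φ i ω ∂μ = ∫ ω, ∏ i, (μ[φ i | m]) ω ∂μ :=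
    (integral_condExp hm).symm.trans (integral_congr_ae hci)
  rw [key]
  -- generalised Hölder for the a.e.-bounded shielded means `μ[φᵢ | m]`
  refine abs_integral_prod_le_of_ae_bdd hn (fun i => μ[φ i | m])
    (fun i => (stronglyMeasurable_condExp.mono hm).aestronglyMeasurable) fun i => ?_
  obtain ⟨M, hM⟩ := hφb i
  exact ⟨M, ae_bdd_abs_condExp_of_ae_bdd_abs (Eventually.of_forall hM)⟩

end Summit.QuantumFields.YangMills.Theorems.TemperedCurvatureMoments.Sketch

end
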